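import Mathlib.Analysis.SpecialFunctions.Pow.Deriv
import Mathlib.Analysis.SpecialFunctions.Pow.Asymptotics
import Literature.NumberTheory.LFunctions.AFECoefficient
import Literature.Geometry.ComplexAnalytic.PhamBrieskornJoin
import Summits.Schanuel.Schanuel.Theorems.ZilberEacComplexMovingPolydisc
import Summits.Schanuel.Schanuel.Theorems.ZilberEacComplexBranchPuncture
import HarnessLib

/-!
# EC over cyclic covers `xₙ^e = P(x')` (non-graph bases) with Brownawell–Masser puncture fibre

A new case of Zilber's Exponential-Algebraic Closedness in the range `dim π₁(V) = n - 1` (first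
open rung, Mantova–Masser, PLMS 129 (2024), §1 p. 5) whose base is NOT a graph over a coordinate
hyperplane: the hypersurface `S = {xₙ^e = P(x₁, …, xₛ)}` (`e ≥ 1`; e.g. the complex sphere
`x₁² + x₂² + x₃² = r`, `e = 2`, `P = r - x₁² - x₂²`). Along a lattice ray `x' = 2πi m q + O(ρ m)`
with `P_D(2πi q)` off the cut `(-∞, 0]`, the branch `xₙ = ω · P(x')^{1/e}` (`ω^e = 1`) is
holomorphic and `Re xₙ = m^{D/e} (Re(ω P_D(2πi q)^{1/e}) + o(1))`; when this is negative, `e^{xₙ}`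
tends to the puncture super-polynomially and the abstract branch-puncture theorem
`exists_expPoint_branchBM_avoiding` applies.

* `ofReal_mul_mem_slitPlane`, `re_mul_ofReal_mul_cpow`, `norm_cpow_inv_nat_le` — helpers (the scaling
  identity `(r u)^c = r^c u^c` and the cast `(e:ℂ)⁻¹ = ((e:ℝ)⁻¹:ℂ)` are reused from
  `Literature.NumberTheory.LFunctions.AFE.ofReal_mul_cpow`, `Literature.Geometry.ComplexAnalytic.PhamBrieskorn.natCast_inv_eq`);
* `cyclicRoot_control` — holomorphy domain, decay `Re(ω P^{1/e}) ≤ -c m^{D/e}` and size of the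
  branch on the balls `B(2πi m q, ρ m)`;
* `exists_expPoint_cyclicCoverBM_avoiding` — **EC for `{xₙ^e = P(x'), (x', (yⱼ - yₙ Fⱼ(yₙ, xₙ, x'))ⱼ) ∈ W}`**
  (`W` Brownawell–Masser) given one lattice direction with `P_D(2πi q₀) ∉ (-∞,0]` and
  `Re(ω P_D(2πi q₀)^{1/e}) < 0`; exponential points Zariski dense over the base;
* `cyclicCoverBM_inter_expGraph_nonempty` — EC vocabulary;
* `sphereBM_inter_expGraph_nonempty` — the complex spheres `x₁² + ⋯ + xₙ² = r` (`n ≥ 2`) as bases.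

HONEST FRAMING: a modest new sub-rung of EAC; nothing here bears on Schanuel's conjecture.
-/

noncomputable section

open Complex MvPolynomial Metric Set Filter Topology
open Literature.NumberTheory.Transcendental

set_option linter.dupNamespace false

namespace Summit.Schanuel.Schanuel.Theorems

/-! ### Helpers on the slit plane and roots -/

/-- Positive real multiples preserve the slit plane. [folklore] -/
theorem ofReal_mul_mem_slitPlane {r : ℝ} (hr : 0 < r) {u : ℂ} (hu : u ∈ slitPlane) :
    (r : ℂ) * u ∈ slitPlane := by
  rw [mem_slitPlane_iff] at hu ⊢
  rw [Complex.re_ofReal_mul, Complex.im_ofReal_mul]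
  rcases hu with h | h
  · exact Or.inl (mul_pos hr h)
  · exact Or.inr (mul_ne_zero hr.ne' h)

/-- `Re(ω (r u)^{1/e}) = r^{1/e} Re(ω u^{1/e})` for real `r > 0`, `u ≠ 0`. [folklore] -/
theorem re_mul_ofReal_mul_cpow {r : ℝ} (hr : 0 < r) {u : ℂ} (hu : u ≠ 0) (ω : ℂ) (y : ℝ) :
    (ω * ((r : ℂ) * u) ^ (y : ℂ)).re = r ^ y * (ω * u ^ (y : ℂ)).re := by
  rw [Literature.NumberTheory.LFunctions.AFE.ofReal_mul_cpow hr hu, ← Complex.ofReal_cpow hr.le, ← mul_assoc,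
    mul_comm ω, mul_assoc, Complex.re_ofReal_mul]

/-- `‖u^{1/e}‖ ≤ 1 + ‖u‖` for `e ≥ 1`. [folklore] -/
theorem norm_cpow_inv_nat_le (u : ℂ) {e : ℕ} (he : 0 < e) :
    ‖u ^ (((e : ℝ)⁻¹ : ℝ) : ℂ)‖ ≤ 1 + ‖u‖ := by
  rw [Complex.norm_cpow_real]
  have hy0 : 0 ≤ (e : ℝ)⁻¹ := by positivity
  have hy1 : (e : ℝ)⁻¹ ≤ 1 := inv_le_one_of_one_le₀ (by exact_mod_cast he)
  rcases le_or_gt ‖u‖ 1 with h | h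
  · have := Real.rpow_le_one (norm_nonneg u) h hy0
    linarith [norm_nonneg u]
  · have h1 : ‖u‖ ^ (e : ℝ)⁻¹ ≤ ‖u‖ ^ (1 : ℝ) := Real.rpow_le_rpow_of_exponent_le h.le hy1
    rw [Real.rpow_one] at h1
    linarith

/-! ### The root branch along a lattice ray -/

/-- **Control of the branch `ω P^{1/e}` along a ray.** Let `P ∈ ℂ[x₁..xₛ]` have degree `D`
and leading form with `a := P_D(v)` in the slit plane, `e ≥ 1`, and `ω ∈ ℂ` with
`Re(ω a^{1/e}) < 0`. Then there are `ρ, c > 0`, `t₀ ≥ 1` such that for `m ≥ t₀` and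
`z ∈ B(m v, ρ m)`: `P(z)` lies in the slit plane, `Re(ω P(z)^{1/e}) ≤ -c m^{D/e}`, and
`‖P(z)^{1/e}‖ ≤ 1 + ‖P(z)‖`. (Leading-form asymptotics `P(z) = m^D (a + O(ε))`, scaling
`(m^D u)^{1/e} = m^{D/e} u^{1/e}`, continuity of `u ↦ ω u^{1/e}` at `a`.) [folklore] -/
theorem cyclicRoot_control {s : ℕ} (P : MvPolynomial (Fin s) ℂ) (v : Fin s → ℂ)
    (ha : eval v (homogeneousComponent P.totalDegree P) ∈ slitPlane) {e : ℕ} (he : 0 < e)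
    (ω : ℂ) (hsign : (ω * (eval v (homogeneousComponent P.totalDegree P)) ^ ((e : ℂ)⁻¹)).re < 0) :
    ∃ ρ : ℝ, 0 < ρ ∧ ∃ c : ℝ, 0 < c ∧ ∃ t₀ : ℝ, 1 ≤ t₀ ∧ ∀ m : ℕ, t₀ ≤ (m : ℝ) →
      ∀ z ∈ ball ((m : ℂ) • v) (ρ * m),
        eval z P ∈ slitPlane ∧
        (ω * (eval z P) ^ ((e : ℂ)⁻¹)).re ≤ -(c * (m : ℝ) ^ ((P.totalDegree : ℝ) / e)) ∧
        ‖(eval z P) ^ ((e : ℂ)⁻¹)‖ ≤ 1 + ‖eval z P‖ := by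
  set D := P.totalDegree with hDdef
  set a := eval v (homogeneousComponent D P) with hadef
  set f : ℂ → ℝ := fun u => (ω * u ^ ((e : ℂ)⁻¹)).re with hf
  have hfa : f a < 0 := hsign
  -- continuity of `f` at `a`
  have hcont : ContinuousAt f a := by
    have h1 : ContinuousAt (fun u : ℂ => u ^ ((e : ℂ)⁻¹)) a := continuousAt_cpow_const ha
    exact Complex.continuous_re.continuousAt.comp (continuousAt_const.mul h1)
  obtain ⟨δ₂, hδ₂, hδ₂f⟩ := Metric.continuousAt_iff.mp hcont (-f a / 2) (by linarith)
  -- openness of the slit plane at `a`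
  obtain ⟨δ₁, hδ₁, hδ₁s⟩ := Metric.isOpen_iff.mp isOpen_slitPlane a ha
  set ε : ℝ := min δ₁ δ₂ / 2 with hε
  have hεpos : 0 < ε := by rw [hε]; exact half_pos (lt_min hδ₁ hδ₂)
  have hεδ₁ : ε < δ₁ := by
    rw [hε]; linarith [min_le_left δ₁ δ₂, lt_min hδ₁ hδ₂]
  have hεδ₂ : ε < δ₂ := by
    rw [hε]; linarith [min_le_right δ₁ δ₂, lt_min hδ₁ hδ₂]
  obtain ⟨ρ, hρ, t₀, ht₀, hnear⟩ := eval_near_natMul_add P v hεpos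
  refine ⟨ρ, hρ, -f a / 2, by linarith, t₀, ht₀, fun m hm z hz => ?_⟩
  have hm0 : (0 : ℝ) < m := by linarith
  have hmD : (0 : ℝ) < (m : ℝ) ^ D := pow_pos hm0 D
  -- `z = m v + η`
  rw [mem_ball, dist_eq_norm] at hz
  set η : Fin s → ℂ := z - (m : ℂ) • v with hη
  have hzη : z = (fun i => (m : ℂ) * v i) + η := by
    funext i; simp [hη, Pi.smul_apply, smul_eq_mul]
  have hP := hnear m hm η hz.le
  rw [← hzη] at hP
  -- `u := P(z) / m^D` is `ε`-close to `a`
  set u : ℂ := (((m : ℝ) ^ D)⁻¹ : ℝ) * eval z P with hu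
  have hPu : eval z P = (((m : ℝ) ^ D : ℝ) : ℂ) * u := by
    rw [hu, ← mul_assoc, ← Complex.ofReal_mul, mul_inv_cancel₀ hmD.ne', Complex.ofReal_one,
      one_mul]
  have hua : dist u a < ε ∨ dist u a = ε → True := fun _ => trivial
  have hdist : dist u a ≤ ε := by
    rw [dist_eq_norm]
    have h1 : u - a = (((m : ℝ) ^ D)⁻¹ : ℝ) * (eval z P - (m : ℂ) ^ D * a) := by
      rw [hu, mul_sub]
      congr 1
      rw [← mul_assoc]
      have : ((((m : ℝ) ^ D)⁻¹ : ℝ) : ℂ) * (m : ℂ) ^ D = 1 := by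
        push_cast
        exact inv_mul_cancel₀ (by exact_mod_cast hmD.ne')
      rw [this, one_mul]
    rw [h1, norm_mul, Complex.norm_real, Real.norm_of_nonneg (by positivity)]
    calc ((m : ℝ) ^ D)⁻¹ * ‖eval z P - (m : ℂ) ^ D * a‖ ≤ ((m : ℝ) ^ D)⁻¹ * (ε * (m : ℝ) ^ D) :=
          mul_le_mul_of_nonneg_left hP (by positivity)
      _ = ε := by field_simp
  have hu_slit : u ∈ slitPlane := hδ₁s (mem_ball.mpr (lt_of_le_of_lt hdist hεδ₁))
  have hu0 : u ≠ 0 := slitPlane_ne_zero hu_slit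
  have hfu : f u ≤ f a / 2 := by
    have h := hδ₂f (lt_of_le_of_lt hdist hεδ₂)
    rw [Real.dist_eq, abs_lt] at h
    linarith [h.2]
  refine ⟨?_, ?_, ?_⟩
  · rw [hPu]; exact ofReal_mul_mem_slitPlane hmD hu_slit
  · rw [hPu, Literature.Geometry.ComplexAnalytic.PhamBrieskorn.natCast_inv_eq, re_mul_ofReal_mul_cpow hmD hu0]
    have hscale : ((m : ℝ) ^ D) ^ ((e : ℝ)⁻¹) = (m : ℝ) ^ ((D : ℝ) / e) := by
      rw [← Real.rpow_natCast, ← Real.rpow_mul hm0.le, div_eq_mul_inv]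
    rw [hscale]
    have hfu' : (ω * u ^ (((e : ℝ)⁻¹ : ℝ) : ℂ)).re ≤ f a / 2 := by
      rw [← Literature.Geometry.ComplexAnalytic.PhamBrieskorn.natCast_inv_eq]; exact hfu
    have hpos : (0 : ℝ) < (m : ℝ) ^ ((D : ℝ) / e) := Real.rpow_pos_of_pos hm0 _
    nlinarith
  · rw [Literature.Geometry.ComplexAnalytic.PhamBrieskorn.natCast_inv_eq]; exact norm_cpow_inv_nat_le _ he

/-! ### EC over cyclic covers with Brownawell–Masser puncture fibre -/

/-- The admissibility cone for the branch `ω P^{1/e}`: `P_D(w) ∈ slitPlane` and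
`Re(ω P_D(w)^{1/e}) < 0` is an open condition on `w ∈ ℂˢ`, stable under positive dilations.
[folklore] -/
theorem isOpen_cyclicRoot_cone {s : ℕ} (Pd : MvPolynomial (Fin s) ℂ) (e : ℕ) (ω : ℂ) :
    IsOpen {w : Fin s → ℂ | eval w Pd ∈ slitPlane ∧ (ω * (eval w Pd) ^ ((e : ℂ)⁻¹)).re < 0} := by
  rw [isOpen_iff_mem_nhds]
  rintro w ⟨hw1, hw2⟩
  have hc : ContinuousAt (fun w : Fin s → ℂ => eval w Pd) w :=
    (MvPolynomial.continuous_eval Pd).continuousAt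
  have h1 : ∀ᶠ w' in 𝓝 w, eval w' Pd ∈ slitPlane := hc.preimage_mem_nhds (isOpen_slitPlane.mem_nhds hw1)
  have hf : ContinuousAt (fun w' : Fin s → ℂ => (ω * (eval w' Pd) ^ ((e : ℂ)⁻¹)).re) w := by
    have h2 : ContinuousAt (fun u : ℂ => u ^ ((e : ℂ)⁻¹)) (eval w Pd) := continuousAt_cpow_const hw1
    have h3 : ContinuousAt (fun w' : Fin s → ℂ => (eval w' Pd) ^ ((e : ℂ)⁻¹)) w :=
      ContinuousAt.comp (f := fun w' : Fin s → ℂ => eval w' Pd) h2 hc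
    exact Complex.continuous_re.continuousAt.comp (continuousAt_const.mul h3)
  have h3 : ∀ᶠ w' in 𝓝 w, (ω * (eval w' Pd) ^ ((e : ℂ)⁻¹)).re < 0 :=
    hf.eventually (eventually_lt_nhds hw2)
  exact h1.and h3

/-- **EC over a cyclic cover `xₙ^e = P(x')` with Brownawell–Masser puncture fibre, exponential
points Zariski dense over the base.** Let `e ≥ 1`, `P ∈ ℂ[x₁..xₛ]` of degree `D ≥ 1` with
leading form `P_D`, and `q₀ ∈ ℤˢ`, `ω ∈ ℂ` with `ω^e = 1`, `P_D(2πi q₀) ∉ (-∞, 0]` and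
`Re(ω · P_D(2πi q₀)^{1/e}) < 0` (principal root). Let `W ⊆ ℂˢ × ℂˢ` be a Brownawell–Masser variety
(irreducible, `dim W = s`, dominant additive projection of the torus part) and
`Fⱼ ∈ ℂ[u, w, x₁..xₛ]`, `h ∈ ℂ[x'] ∖ 0` arbitrary. Then there are `x' ∈ ℂˢ`, `xₙ ∈ ℂ` with
`h(x') ≠ 0`, `xₙ^e = P(x')` and `(x', (e^{xⱼ} - e^{xₙ} Fⱼ(e^{xₙ}, xₙ, x'))ⱼ) ∈ W` — an exponential
point of the `(s+1)`-fold `V = {xₙ^e = P(x'), (x', (yⱼ - yₙ Fⱼ(yₙ, xₙ, x'))ⱼ) ∈ W}` whose additive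
projection is the hypersurface `xₙ^e = P(x')`, in general not a graph over any coordinate
hyperplane (first open range of Exponential-Algebraic Closedness, `dim π₁ V = n - 1`,
Mantova–Masser 2024 §1 p. 5). For `e = 1`, `ω = 1` this is the graph case with
`Re P_D(2πi q₀) < 0`. New. [cite: MantovaMasser2023, §1 p.5 (the open case dim π(V) = 2 in ℂ³×ℂˣ³)] -/
theorem exists_expPoint_cyclicCoverBM_avoiding {s : ℕ} {e : ℕ} (he : 0 < e)
    (P : MvPolynomial (Fin s) ℂ) (hD : 0 < P.totalDegree) (q₀ : Fin s → ℤ) (ω : ℂ) (hω : ω ^ e = 1)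
    (hslit : eval (fun j => 2 * Real.pi * I * (q₀ j : ℂ))
      (homogeneousComponent P.totalDegree P) ∈ slitPlane)
    (hsign : (ω * (eval (fun j => 2 * Real.pi * I * (q₀ j : ℂ))
      (homogeneousComponent P.totalDegree P)) ^ ((e : ℂ)⁻¹)).re < 0)
    (W : Set (Fin s ⊕ Fin s → ℂ)) (hW : IsIrreducibleClosed ℂ W) (hdim : zariskiDim ℂ W = s)
    (hdom : HasDominantAddProjection ℂ (W ∩ torusLocus ℂ s))
    (F : Fin s → MvPolynomial (Fin (s + 2)) ℂ) (h : MvPolynomial (Fin s) ℂ) (hh : h ≠ 0) :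
    ∃ x : Fin s → ℂ, ∃ xn : ℂ, eval x h ≠ 0 ∧ xn ^ e = eval x P ∧
      (Sum.elim x (fun j => exp (x j) - exp xn *
        eval (Fin.cons (exp xn) (Fin.cons xn x : Fin (s + 1) → ℂ)) (F j)) : Fin s ⊕ Fin s → ℂ) ∈ W := by
  classical
  set D := P.totalDegree with hDdef
  set Pd := homogeneousComponent D P with hPd
  have hPdhom : Pd.IsHomogeneous D := homogeneousComponent_isHomogeneous D P
  -- admissible directions
  set adm : (Fin s → ℤ) → Prop := fun q =>
    eval (fun j => 2 * Real.pi * I * (q j : ℂ)) Pd ∈ slitPlane ∧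
      (ω * (eval (fun j => 2 * Real.pi * I * (q j : ℂ)) Pd) ^ ((e : ℂ)⁻¹)).re < 0 with hadm
  have hcone : ∀ t : ℝ, 0 < t → ∀ w : Fin s → ℂ,
      (eval w Pd ∈ slitPlane ∧ (ω * (eval w Pd) ^ ((e : ℂ)⁻¹)).re < 0) →
      (eval ((t : ℂ) • w) Pd ∈ slitPlane ∧ (ω * (eval ((t : ℂ) • w) Pd) ^ ((e : ℂ)⁻¹)).re < 0) := by
    rintro t ht w ⟨hw1, hw2⟩
    have htD : (0 : ℝ) < t ^ D := pow_pos ht D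
    have hev : eval ((t : ℂ) • w) Pd = ((t ^ D : ℝ) : ℂ) * eval w Pd := by
      rw [hPdhom.eval_smul_eq, Complex.ofReal_pow]
    refine ⟨by rw [hev]; exact ofReal_mul_mem_slitPlane htD hw1, ?_⟩
    rw [hev, Literature.Geometry.ComplexAnalytic.PhamBrieskorn.natCast_inv_eq, re_mul_ofReal_mul_cpow htD (slitPlane_ne_zero hw1)]
    rw [Literature.Geometry.ComplexAnalytic.PhamBrieskorn.natCast_inv_eq] at hw2
    exact mul_neg_of_pos_of_neg (Real.rpow_pos_of_pos htD _) hw2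
  have hadm_all : ∀ Q : MvPolynomial (Fin s) ℂ, Q ≠ 0 →
      ∃ q, adm q ∧ eval (fun j => 2 * Real.pi * I * (q j : ℂ)) Q ≠ 0 := by
    intro Q hQ
    obtain ⟨q, hqQ, hq⟩ := exists_good_direction_of_isOpen_cone Q hQ
      (fun w => eval w Pd ∈ slitPlane ∧ (ω * (eval w Pd) ^ ((e : ℂ)⁻¹)).re < 0)
      (isOpen_cyclicRoot_cone Pd e ω) hcone q₀ ⟨hslit, hsign⟩
    exact ⟨q, hq, hqQ⟩
  -- the branch and its radius
  set φ : (Fin s → ℤ) → ℕ → (Fin s → ℂ) → ℂ := fun _ _ z => ω * (eval z P) ^ ((e : ℂ)⁻¹) with hφ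
  have hctrl : ∀ q, adm q → ∃ ρ : ℝ, 0 < ρ ∧ ∃ c : ℝ, 0 < c ∧ ∃ t₀ : ℝ, 1 ≤ t₀ ∧
      ∀ m : ℕ, t₀ ≤ (m : ℝ) → ∀ z ∈ ball ((m : ℂ) • fun j => 2 * Real.pi * I * (q j : ℂ)) (ρ * m),
        eval z P ∈ slitPlane ∧
        (ω * (eval z P) ^ ((e : ℂ)⁻¹)).re ≤ -(c * (m : ℝ) ^ ((D : ℝ) / e)) ∧
        ‖(eval z P) ^ ((e : ℂ)⁻¹)‖ ≤ 1 + ‖eval z P‖ :=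
    fun q hq => cyclicRoot_control P _ hq.1 he ω hq.2
  set ρ : (Fin s → ℤ) → ℝ := fun q => if hq : adm q then Classical.choose (hctrl q hq) else 1
    with hρ
  have hρspec : ∀ q (hq : adm q), 0 < ρ q ∧ ∃ c : ℝ, 0 < c ∧ ∃ t₀ : ℝ, 1 ≤ t₀ ∧
      ∀ m : ℕ, t₀ ≤ (m : ℝ) → ∀ z ∈ ball ((m : ℂ) • fun j => 2 * Real.pi * I * (q j : ℂ)) (ρ q * m),
        eval z P ∈ slitPlane ∧
        (ω * (eval z P) ^ ((e : ℂ)⁻¹)).re ≤ -(c * (m : ℝ) ^ ((D : ℝ) / e)) ∧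
        ‖(eval z P) ^ ((e : ℂ)⁻¹)‖ ≤ 1 + ‖eval z P‖ := by
    intro q hq
    have h1 : ρ q = Classical.choose (hctrl q hq) := by simp only [hρ, dif_pos hq]
    rw [h1]
    exact Classical.choose_spec (hctrl q hq)
  -- growth of `P`
  obtain ⟨CP, hCP, NP, hCNP⟩ :=
    Literature.NumberTheory.Transcendental.HypersurfaceCover.exists_norm_eval_le_pow P
  -- hypotheses of the abstract theorem
  have hφhyp : ∀ q, adm q → 0 < ρ q ∧ ∃ K : ℝ, 0 ≤ K ∧ ∃ Nφ : ℕ, ∀ᶠ m : ℕ in atTop,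
      DifferentiableOn ℂ (φ q m)
        (ball ((m : ℂ) • fun i => 2 * Real.pi * I * (q i : ℂ)) (ρ q * m)) ∧
      ∀ z ∈ ball ((m : ℂ) • fun i => 2 * Real.pi * I * (q i : ℂ)) (ρ q * m),
        ‖φ q m z‖ ≤ K * (m : ℝ) ^ Nφ := by
    intro q hq
    obtain ⟨hρq, c, hc, t₀, ht₀, hball⟩ := hρspec q hq
    set vq : Fin s → ℂ := fun i => 2 * Real.pi * I * (q i : ℂ) with hvq
    set K : ℝ := ‖ω‖ * (1 + CP * (2 + ‖vq‖ + ρ q) ^ NP) with hK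
    refine ⟨hρq, K, by positivity, NP, ?_⟩
    filter_upwards [tendsto_natCast_atTop_atTop.eventually_ge_atTop t₀] with m hm
    have hm1 : (1 : ℝ) ≤ m := ht₀.trans hm
    have hm0 : (0 : ℝ) < m := by linarith
    have hfacts := hball m hm
    refine ⟨?_, fun z hz => ?_⟩
    · -- holomorphy: `P(z)` stays in the slit plane on the ball
      have hmaps : MapsTo (fun z : Fin s → ℂ => eval z P)
          (ball ((m : ℂ) • vq) (ρ q * m)) slitPlane := fun z hz => (hfacts z hz).1
      exact ((differentiable_mvPolynomial_eval P).differentiableOn.cpow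
        (differentiableOn_const _) hmaps).const_mul ω
    · obtain ⟨-, -, hnorm⟩ := hfacts z hz
      rw [mem_ball, dist_eq_norm] at hz
      have hzn : ‖z‖ ≤ (‖vq‖ + ρ q) * m := by
        calc ‖z‖ = ‖(m : ℂ) • vq + (z - (m : ℂ) • vq)‖ := by rw [add_sub_cancel]
          _ ≤ ‖(m : ℂ) • vq‖ + ‖z - (m : ℂ) • vq‖ := norm_add_le _ _
          _ ≤ m * ‖vq‖ + ρ q * m := by
              rw [norm_smul, Complex.norm_natCast]; exact add_le_add le_rfl hz.le
          _ = (‖vq‖ + ρ q) * m := by ring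
      have hPz : ‖eval z P‖ ≤ CP * ((2 + ‖vq‖ + ρ q) * m) ^ NP := by
        refine (hCNP z).trans (mul_le_mul_of_nonneg_left ?_ hCP)
        refine pow_le_pow_left₀ (by positivity) ?_ _
        have := norm_nonneg vq
        nlinarith
      have hmN : (1 : ℝ) ≤ (m : ℝ) ^ NP := one_le_pow₀ hm1
      calc ‖φ q m z‖ = ‖ω‖ * ‖(eval z P) ^ ((e : ℂ)⁻¹)‖ := norm_mul _ _
        _ ≤ ‖ω‖ * (1 + CP * ((2 + ‖vq‖ + ρ q) * m) ^ NP) :=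
            mul_le_mul_of_nonneg_left (hnorm.trans (by linarith)) (norm_nonneg _)
        _ ≤ ‖ω‖ * ((1 + CP * (2 + ‖vq‖ + ρ q) ^ NP) * (m : ℝ) ^ NP) := by
            refine mul_le_mul_of_nonneg_left ?_ (norm_nonneg _)
            rw [mul_pow]
            have : 0 ≤ CP * (2 + ‖vq‖ + ρ q) ^ NP := by positivity
            nlinarith
        _ = K * (m : ℝ) ^ NP := by rw [hK]; ring
  have hdecay : ∀ q, adm q → ∀ Nd : ℕ, ∀ᶠ m : ℕ in atTop,
      ∀ z ∈ ball ((m : ℂ) • fun i => 2 * Real.pi * I * (q i : ℂ)) (ρ q * m),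
        (φ q m z).re ≤ -(Nd * Real.log m) := by
    intro q hq Nd
    obtain ⟨hρq, c, hc, t₀, ht₀, hball⟩ := hρspec q hq
    have hr : (0 : ℝ) < (D : ℝ) / e := by positivity
    -- `Nd log m ≤ c m^{D/e}` eventually
    have hlo := (isLittleO_log_rpow_atTop hr).def (show (0 : ℝ) < c / (Nd + 1) by positivity)
    have hev : ∀ᶠ m : ℕ in atTop, (Nd : ℝ) * Real.log m ≤ c * (m : ℝ) ^ ((D : ℝ) / e) := by
      filter_upwards [tendsto_natCast_atTop_atTop.eventually hlo,
        tendsto_natCast_atTop_atTop.eventually_ge_atTop (1 : ℝ)] with m hm hm1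
      rw [Real.norm_of_nonneg (Real.log_nonneg hm1),
        Real.norm_of_nonneg (Real.rpow_nonneg (by linarith) _)] at hm
      have hpos : (0 : ℝ) ≤ (m : ℝ) ^ ((D : ℝ) / e) := Real.rpow_nonneg (by linarith) _
      have hlog0 : 0 ≤ Real.log m := Real.log_nonneg hm1
      have h1 : (Nd : ℝ) * Real.log m ≤ (Nd + 1) * Real.log m := by nlinarith
      have h2 : ((Nd : ℝ) + 1) * (c / (Nd + 1) * (m : ℝ) ^ ((D : ℝ) / e)) =
          c * (m : ℝ) ^ ((D : ℝ) / e) := by field_simp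
      nlinarith
    filter_upwards [hev, tendsto_natCast_atTop_atTop.eventually_ge_atTop t₀] with m hm hmt
    intro z hz
    exact (hball m hmt z hz).2.1.trans (by linarith)
  obtain ⟨q, hq, m, x, hxball, hxh, hxW⟩ := exists_expPoint_branchBM_avoiding W hW hdim hdom adm
    hadm_all ρ φ hφhyp hdecay F h hh
  refine ⟨x, φ q m x, hxh, ?_, hxW⟩
  -- `(ω P^{1/e})^e = P`
  show (ω * (eval x P) ^ ((e : ℂ)⁻¹)) ^ e = eval x P
  rw [mul_pow, hω, one_mul, Complex.cpow_nat_inv_pow _ he.ne']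

end Summit.Schanuel.Schanuel.Theorems
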